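import Summits.BirchSwinnertonDyer.BirchSwinnertonDyer.Theorems.GenusKolyvaginAtTwoGenusPrimitiveSupplyAtTwoTwistSelmerTransferDownRat
import Summits.BirchSwinnertonDyer.BirchSwinnertonDyer.Theorems.GenusKolyvaginAtTwoGenusPrimitiveSupplyAtTwoTwistingPrimeDepthOne
import HarnessLib

/-!
# Route `GenusKolyvaginAtTwo`, crux #2 `GenusPrimitiveSupplyAtTwo` (stmt-BirchSwinnertonDyer-22136):
# the SUPPLY half of the level law WITHOUT `cor34i_singleton_rat` — the genus pair at a depth-`M` Kolyvagin prime is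
# `2`-Selmer-minimal, modulo Poitou–Tate duality and Tate's local Euler characteristic ONLY

Width seat `bsd-line-gk2-p5` g8 (cell `bsd-f1-sign2`, SUPPLY lineage), eleventh file of the series (crux workfile
`Lines/genus-supply-mr-instantiation.md`). THEOREMS ONLY (no definition, no named fact, no `sorry`); helper
`--supports stmt-BirchSwinnertonDyer-22136`; no item is closed; BSD is not proved by any of this.

WHAT. gk2-p4 g8's capstones `GenusKolyTwistingPrime.exists_kolyvaginPrime_pow_genusPair_selmer_of_cor34i` (depth `M`, under
non-entanglement at level `2^M`), `…_pow_one_…_of_cor34i` (`M = 1`, unconditional non-entanglement) and `…_of_cor34i_of_half`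
(twin hypothesis at point level) take the PRINT named fact `h34 : MazurRubin2010.cor34i_singleton_rat`, and use ONLY its DOWN
half (twice: for `W` at `#Sel₂ = 4` and for the twin `Wd` at `#Sel₂ = 2`). This file re-derives all three with `h34` REPLACED
by the two displayed print facts `hPT : poitouTate_selmerStructure_duality_real ℚ` (Milne I.4.10) and
`hEP : ∀ v, localEulerPoincareCharacteristic ℚ_v` (Tate; Milne I.2.8), through this seat's kernel DOWN theorem
`GenusKolyTwistLocal.natCard_selmerGroup_eq_two_mul_of_not_le_strictLocalKer` (p624297; Lemmas 2.10 (i)(ii)(iv), 2.11 and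
Prop. 3.3's count being kernel theorems of this series, X11b and the lead's p622198). The proofs are gk2-p4's, verbatim but for
the two `h34` invocations. So the SUPPLY half of the level law on the live reach (`Δ_W < 0`, `ρ̄_{W,2}` onto, `#Sel₂(W) = 4`,
twin with `#Sel₂ = 2`) is kernel modulo {PT, Tate χ} + the proved Čebotarev inputs; the open content of the crux is unchanged
(the `2`-primitivity / Zhang-at-`2` half, items 24947 / 22136 themselves).

References: [MazurRubin2010] Prop. 3.3, Cor. 3.4 (i), Lemma 3.5; [MilneADT2006] I Thm. 2.8, I Thm. 4.10; [GrossLMS1991] §3;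
[McCallumLMS1991] §4.
-/

set_option linter.dupNamespace false -- tree convention: `Summit.BirchSwinnertonDyer.BirchSwinnertonDyer.Theorems` (summit = sub-problem)
set_option autoImplicit false

noncomputable section

open scoped Classical Pointwise

namespace Summit.BirchSwinnertonDyer.BirchSwinnertonDyer.Theorems.GenusKolyTwistLocal

open WeierstrassCurve NumberField IsDedekindDomain Field
open Literature.NumberTheory.GaloisRepresentations Literature.NumberTheory.EllipticCurves
open Literature.NumberTheory Literature.NumberTheory.GaloisCohomology
open Summit.BirchSwinnertonDyer.BirchSwinnertonDyer.Theorems.GenusKolyTwistingPrime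

variable (W : WeierstrassCurve ℚ) [W.IsElliptic] [W.IsGloballyMinimal] {K : Type} [Field K] [NumberField K]

/-! ## §27 The depth-`M` genus pair is `2`-Selmer-minimal, modulo {PT, Tate χ} -/

/-- **PRIME-LEVEL SUPPLY OF THE LEVEL LAW AT DEPTH `M`, SELMER SIDE — modulo Poitou–Tate duality and Tate's local Euler
characteristic (NO `cor34i_singleton_rat`), under non-entanglement at level `2^M`.** `W/ℚ` globally minimal elliptic with
`Δ(W) < 0`, `ρ̄_{W,2}` onto, `#Sel₂(W) = 4`; `K` imaginary quadratic; `Wd` a globally minimal model of the twin `W^{(d_K)}` with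
`#Sel₂(Wd) = 2`; `M ≥ 1`; some Selmer class of `W` and of `Wd` does not die on `Γ_{ℚ(E[2^M])}`. THEN beyond every finite `B₀`
there is a prime `ℓ ≡ 7 (mod 8)`, Kolyvagin for `(E, K, 2)` and of depth `M` (`Frob_ℓ = Frob_∞` on `K(E[2^M])`, `2^M ∣ ℓ + 1`,
`2^M ∣ a_ℓ(W)`), such that EVERY elliptic model of `W^{(−ℓ)}` has `#Sel₂ = 2` and every elliptic model of `Wd^{(−ℓ)}` has
`#Sel₂ = 1`. gk2-p4's `exists_kolyvaginPrime_pow_genusPair_selmer_of_cor34i` with the two (DOWN-direction) uses of `h34`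
replaced by `natCard_selmerGroup_eq_two_mul_of_not_le_strictLocalKer`. CONDITIONAL on the displayed `hPT`, `hEP` only.
BSD is not proved by this. [cite: MazurRubin2010, Prop. 3.3, Cor. 3.4 (i), Lemma 3.5] [cite: MilneADT2006, I Thm. 2.8, I Thm. 4.10]
[cite: GrossLMS1991, §3 (3.1)–(3.3)] [cite: McCallumLMS1991, §4 (Kolyvagin primes of level M)] -/
theorem exists_kolyvaginPrime_pow_genusPair_selmer_of_duality
    (hPT : poitouTate_selmerStructure_duality_real ℚ)
    (hEP : ∀ v : HeightOneSpectrum (𝓞 ℚ), localEulerPoincareCharacteristic (v.adicCompletion ℚ))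
    (hsurj : W.HasSurjectiveModNGaloisRep 2) (hΔ : W.Δ < 0) (h4 : Nat.card (W.selmerGroup 2) = 4)
    (hK : IsImaginaryQuadratic K) {Wd : WeierstrassCurve ℚ} [Wd.IsElliptic] [Wd.IsGloballyMinimal]
    {C : VariableChange ℚ} (hWd : C • W.quadraticTwist (discr K : ℚ) = Wd)
    (h2 : Nat.card (Wd.selmerGroup 2) = 2) {M : ℕ} (hM : 1 ≤ M)
    (hS : ∃ c ∈ W.selmerGroup 2, ∃ h ∈ torsionFixing W ((2 ^ M : ℕ) : ℤ), h1Eval W (2 : ℤ) c h ≠ 0)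
    (hS' : ∃ c' ∈ Wd.selmerGroup 2, ∃ h ∈ torsionFixing W ((2 ^ M : ℕ) : ℤ), h1Eval Wd (2 : ℤ) c' h ≠ 0)
    (B₀ : Finset ℕ) :
    ∃ ℓ : ℕ, ∃ _ : Fact ℓ.Prime, ℓ ∉ B₀ ∧ ℓ % 8 = 7 ∧ IsKolyvaginPrime (W.conductorNorm ℤ) W K 2 ℓ ∧
      FrobEqFrobInfty W K (2 ^ M) ℓ ∧ 2 ^ M ∣ ℓ + 1 ∧ ((2 : ℤ) ^ M) ∣ W.frobeniusTrace ℓ ∧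
      (∀ (W₁ : WeierstrassCurve ℚ) [W₁.IsElliptic],
        (∃ C₁ : VariableChange ℚ, C₁ • W.quadraticTwist (-(ℓ : ℚ)) = W₁) →
          Nat.card (W₁.selmerGroup 2) = 2) ∧
      (∀ (W₂ : WeierstrassCurve ℚ) [W₂.IsElliptic],
        (∃ C₂ : VariableChange ℚ, C₂ • Wd.quadraticTwist (-(ℓ : ℚ)) = W₂) →
          Nat.card (W₂.selmerGroup 2) = 1) := by
  have hNW : W.conductorNorm ℤ ≠ 0 := (W.conductorNorm_pos_holds).ne'
  have hNWd : Wd.conductorNorm ℤ ≠ 0 := (Wd.conductorNorm_pos_holds).ne'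
  haveI : NeZero (W.conductorNorm ℤ) := ⟨hNW⟩
  have hd0 : (discr K : ℚ) ≠ 0 := by exact_mod_cast NumberField.discr_ne_zero K
  have hm : 8 * W.conductorNorm ℤ * Wd.conductorNorm ℤ ≠ 0 := by positivity
  obtain ⟨ℓ, hℓF, hℓB₀, hmdvd, hKoly, hFrobM, hnsW, hnsWd⟩ :=
    exists_kolyvaginPrime_pow_not_selmerGroup_le_strictLocalKer_twin W hsurj hΔ hK hM hd0 hWd hS hS' hm
      (W.conductorNorm ℤ) B₀
  have hℓ : ℓ.Prime := hℓF.out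
  have hℓ8 : ℓ % 8 = 7 := by
    have h8 : 8 ∣ ℓ + 1 := (Dvd.intro _ rfl).trans ((Dvd.intro _ rfl).trans hmdvd)
    omega
  have hℓ2 : ℓ ≠ 2 := by omega
  -- depth: `2^M ∣ ℓ + 1` and `2^M ∣ a_ℓ` (good reduction at `ℓ ∤ N_W`)
  have hdepth1 : 2 ^ M ∣ ℓ + 1 := pow_dvd_add_one_of_frobEqFrobInfty W Nat.prime_two hM hℓ hℓ2 hFrobM
  have hdepth2 : ((2 : ℤ) ^ M) ∣ W.frobeniusTrace ℓ := by
    have hF' := hFrobM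
    obtain ⟨v, -, -, -, hℓv, -⟩ := hF'
    have hℓN : ¬ ℓ ∣ W.conductorNorm ℤ := hKoly.2.1
    have hgood : W.HasGoodReductionAt v := by
      apply hasGoodReductionAt_of_not_dvd_conductorNorm W v
      rw [primesEquiv_eq_of_natCast_mem hℓ hℓv]; exact hℓN
    have h := pow_dvd_frobeniusTraceAt_of_frobEqFrobInfty W Nat.prime_two hM hℓ hℓ2 hFrobM hℓv hgood
    rw [frobeniusTraceAt_eq_frobeniusTrace, primesEquiv_eq_of_natCast_mem hℓ hℓv] at h
    exact_mod_cast h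
  have hcong : ∀ (M' : ℕ), M' ∣ 8 * W.conductorNorm ℤ * Wd.conductorNorm ℤ →
      ∀ p : ℕ, p.Prime → p ∣ M' → p ≠ 2 → (ℓ : ZMod p) = -1 := by
    intro M' hM' p _ hp _
    have h : ((ℓ + 1 : ℕ) : ZMod p) = 0 :=
      (ZMod.natCast_eq_zero_iff _ _).mpr (hp.trans (hM'.trans hmdvd))
    rw [Nat.cast_add, Nat.cast_one] at h
    exact eq_neg_of_add_eq_zero_left h
  have hℓN : ∀ p : ℕ, p.Prime → p ∣ W.conductorNorm ℤ → p ≠ 2 → (ℓ : ZMod p) = -1 :=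
    hcong _ ⟨8 * Wd.conductorNorm ℤ, by ring⟩
  have hℓNd : ∀ p : ℕ, p.Prime → p ∣ Wd.conductorNorm ℤ → p ≠ 2 → (ℓ : ZMod p) = -1 :=
    hcong _ ⟨8 * W.conductorNorm ℤ, by ring⟩
  -- the genus twist of `W`: DOWN from `#Sel₂(W) = 4`
  have hW₁ : ∀ (W₁ : WeierstrassCurve ℚ) [W₁.IsElliptic],
      (∃ C₁ : VariableChange ℚ, C₁ • W.quadraticTwist (-(ℓ : ℚ)) = W₁) →
        Nat.card (W₁.selmerGroup 2) = 2 := by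
    intro W₁ _ hW₁
    obtain ⟨-, -, K₁, _, _, hK₁, hd₁, hodd₁, -, hH₁, h2K₁, -, -⟩ :=
      GenusKolyTwin.exists_heegnerField_of_prime W hℓ hℓ8 hℓN
    have hW₁' : ∃ C₁ : VariableChange ℚ, C₁ • W.quadraticTwist (discr K₁ : ℚ) = W₁ := by
      rw [hd₁]; push_cast; exact hW₁
    have h := natCard_selmerGroup_eq_two_mul_of_not_le_strictLocalKer W hPT hEP hΔ hK₁ hodd₁ hH₁ h2K₁ hd₁ W₁
      hW₁' hnsW
    rw [h4] at h
    omega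
  -- the genus twist of the twin: DOWN from `#Sel₂(Wd) = 2`
  have hΔd : Wd.Δ < 0 := Δ_neg_of_smul_quadraticTwist W hd0 hΔ hWd
  have hW₂ : ∀ (W₂ : WeierstrassCurve ℚ) [W₂.IsElliptic],
      (∃ C₂ : VariableChange ℚ, C₂ • Wd.quadraticTwist (-(ℓ : ℚ)) = W₂) →
        Nat.card (W₂.selmerGroup 2) = 1 := by
    intro W₂ _ hW₂
    obtain ⟨-, -, K₂, _, _, hK₂, hd₂, hodd₂, -, hH₂, h2K₂, -, -⟩ :=
      GenusKolyTwin.exists_heegnerField_of_prime Wd hℓ hℓ8 hℓNd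
    have hW₂' : ∃ C₂ : VariableChange ℚ, C₂ • Wd.quadraticTwist (discr K₂ : ℚ) = W₂ := by
      rw [hd₂]; push_cast; exact hW₂
    have h := natCard_selmerGroup_eq_two_mul_of_not_le_strictLocalKer Wd hPT hEP hΔd hK₂ hodd₂ hH₂ h2K₂ hd₂ W₂
      hW₂' hnsWd
    rw [h2] at h
    omega
  exact ⟨ℓ, hℓF, hℓB₀, hℓ8, hKoly, hFrobM, hdepth1, hdepth2, hW₁, hW₂⟩

/-- **The depth-one case (`M = 1`), both non-entanglement hypotheses discharged, modulo {PT, Tate χ} (NO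
`cor34i_singleton_rat`)**: gk2-p4's `exists_kolyvaginPrime_pow_one_genusPair_selmer_of_cor34i` with `h34` replaced by the
duality facts. BSD is not proved by this.
[cite: MazurRubin2010, Cor. 3.4 (i), Prop. 3.3, Lemma 3.5] [cite: MilneADT2006, I Thm. 2.8, I Thm. 4.10] [cite: GrossLMS1991, §3 (3.1)–(3.3)] -/
theorem exists_kolyvaginPrime_pow_one_genusPair_selmer_of_duality
    (hPT : poitouTate_selmerStructure_duality_real ℚ)
    (hEP : ∀ v : HeightOneSpectrum (𝓞 ℚ), localEulerPoincareCharacteristic (v.adicCompletion ℚ))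
    (hsurj : W.HasSurjectiveModNGaloisRep 2) (hΔ : W.Δ < 0) (h4 : Nat.card (W.selmerGroup 2) = 4)
    (hK : IsImaginaryQuadratic K) {Wd : WeierstrassCurve ℚ} [Wd.IsElliptic] [Wd.IsGloballyMinimal]
    {C : VariableChange ℚ} (hWd : C • W.quadraticTwist (discr K : ℚ) = Wd)
    (h2 : Nat.card (Wd.selmerGroup 2) = 2) (B₀ : Finset ℕ) :
    ∃ ℓ : ℕ, ∃ _ : Fact ℓ.Prime, ℓ ∉ B₀ ∧ ℓ % 8 = 7 ∧ IsKolyvaginPrime (W.conductorNorm ℤ) W K 2 ℓ ∧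
      FrobEqFrobInfty W K (2 ^ 1) ℓ ∧ 2 ^ 1 ∣ ℓ + 1 ∧ ((2 : ℤ) ^ 1) ∣ W.frobeniusTrace ℓ ∧
      (∀ (W₁ : WeierstrassCurve ℚ) [W₁.IsElliptic],
        (∃ C₁ : VariableChange ℚ, C₁ • W.quadraticTwist (-(ℓ : ℚ)) = W₁) →
          Nat.card (W₁.selmerGroup 2) = 2) ∧
      (∀ (W₂ : WeierstrassCurve ℚ) [W₂.IsElliptic],
        (∃ C₂ : VariableChange ℚ, C₂ • Wd.quadraticTwist (-(ℓ : ℚ)) = W₂) →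
          Nat.card (W₂.selmerGroup 2) = 1) := by
  have hd0 : (discr K : ℚ) ≠ 0 := by exact_mod_cast NumberField.discr_ne_zero K
  have hSW : Nat.card (W.selmerGroup 2) ≠ 1 := by rw [h4]; norm_num
  have hSWd : Nat.card (Wd.selmerGroup 2) ≠ 1 := by rw [h2]; norm_num
  exact exists_kolyvaginPrime_pow_genusPair_selmer_of_duality W hPT hEP hsurj hΔ h4 hK hWd h2 le_rfl
    (exists_selmer_h1Eval_ne_of_card_ne_one W hsurj hSW)
    (exists_selmer_h1Eval_ne_twist_of_card_ne_one W hsurj hd0 hWd hSWd) B₀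

/-- **Depth `M` with the twin hypothesis at point level, modulo {PT, Tate χ} (NO `cor34i_singleton_rat`)**: gk2-p4's
`exists_kolyvaginPrime_pow_genusPair_selmer_of_cor34i_of_half` with `h34` replaced by the duality facts — the twin-side
non-entanglement is supplied by a rational point `P ∈ Wd(ℚ)` a half `Q` of which is moved by some element of `Γ_{ℚ(E[2^M])}`.
BSD is not proved by this. [cite: MazurRubin2010, Cor. 3.4 (i), Prop. 3.3, Lemma 3.5] [cite: MilneADT2006, I Thm. 2.8, I Thm. 4.10]
[cite: SilvermanAEC2009, VIII.2 (Kummer pairing)] -/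
theorem exists_kolyvaginPrime_pow_genusPair_selmer_of_duality_of_half
    (hPT : poitouTate_selmerStructure_duality_real ℚ)
    (hEP : ∀ v : HeightOneSpectrum (𝓞 ℚ), localEulerPoincareCharacteristic (v.adicCompletion ℚ))
    (hsurj : W.HasSurjectiveModNGaloisRep 2) (hΔ : W.Δ < 0) (h4 : Nat.card (W.selmerGroup 2) = 4)
    (hK : IsImaginaryQuadratic K) {Wd : WeierstrassCurve ℚ} [Wd.IsElliptic] [Wd.IsGloballyMinimal]
    {C : VariableChange ℚ} (hWd : C • W.quadraticTwist (discr K : ℚ) = Wd)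
    (h2 : Nat.card (Wd.selmerGroup 2) = 2) {M : ℕ} (hM : 1 ≤ M)
    (hS : ∃ c ∈ W.selmerGroup 2, ∃ h ∈ torsionFixing W ((2 ^ M : ℕ) : ℤ), h1Eval W (2 : ℤ) c h ≠ 0)
    (P : Wd.toAffine.Point) (Q : geomPoints Wd) (hQ : (2 : ℤ) • Q = toGeomPoints Wd P)
    (hmove : ∃ h ∈ torsionFixing W ((2 ^ M : ℕ) : ℤ), h • Q ≠ Q) (B₀ : Finset ℕ) :
    ∃ ℓ : ℕ, ∃ _ : Fact ℓ.Prime, ℓ ∉ B₀ ∧ ℓ % 8 = 7 ∧ IsKolyvaginPrime (W.conductorNorm ℤ) W K 2 ℓ ∧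
      FrobEqFrobInfty W K (2 ^ M) ℓ ∧ 2 ^ M ∣ ℓ + 1 ∧ ((2 : ℤ) ^ M) ∣ W.frobeniusTrace ℓ ∧
      (∀ (W₁ : WeierstrassCurve ℚ) [W₁.IsElliptic],
        (∃ C₁ : VariableChange ℚ, C₁ • W.quadraticTwist (-(ℓ : ℚ)) = W₁) →
          Nat.card (W₁.selmerGroup 2) = 2) ∧
      (∀ (W₂ : WeierstrassCurve ℚ) [W₂.IsElliptic],
        (∃ C₂ : VariableChange ℚ, C₂ • Wd.quadraticTwist (-(ℓ : ℚ)) = W₂) →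
          Nat.card (W₂.selmerGroup 2) = 1) := by
  have hd0 : (discr K : ℚ) ≠ 0 := by exact_mod_cast NumberField.discr_ne_zero K
  have h2M : (2 : ℤ) ∣ ((2 ^ M : ℕ) : ℤ) := by
    rw [Nat.cast_pow, Nat.cast_ofNat]; exact dvd_pow_self 2 (by omega : M ≠ 0)
  exact exists_kolyvaginPrime_pow_genusPair_selmer_of_duality W hPT hEP hsurj hΔ h4 hK hWd h2 hM hS
    (exists_selmer_h1Eval_ne_twist_of_smul_half_ne W hd0 hWd h2M P Q hQ hmove) B₀

end Summit.BirchSwinnertonDyer.BirchSwinnertonDyer.Theorems.GenusKolyTwistLocal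

end
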